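import Summits.BirchSwinnertonDyer.BirchSwinnertonDyer.Theorems.ThetaPartnerAtTwoSignedMainConjectureCMTwoRankZeroPTDeepTransferTools
import Summits.BirchSwinnertonDyer.BirchSwinnertonDyer.Theorems.ResidualThetaTransportAtTwoResidualSignedLambdaLowerCMAtTwoCofreeShapiroTransport
import Summits.BirchSwinnertonDyer.BirchSwinnertonDyer.Theorems.PrintCf2SplitBadTwoLayerShapiroUnramified
import Summits.BirchSwinnertonDyer.BirchSwinnertonDyer.Theorems.KatoDescentPotSupersingularUnramifiedLocalConditionSelfDual
import Literature.NumberTheory.GaloisCohomology.UnramifiedOutsideLayerExhaustion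
import Literature.NumberTheory.EllipticCurves.SubgroupSelmerCocycleCriteriaProofs
import Literature.NumberTheory.EllipticCurves.CyclotomicLayerTatePairing
import HarnessLib

/-!
# H46 kernel programme (road C′), brick R1 of `NOTE-B6-SCHEDULE-GEN38` §4: the sockets of `H46Assembly.exists_realiser_of_sockets`
# at the BAD places `w ∈ S ∖ {p}` — the UNRAMIFIED local condition on both sides, with NO reduction hypothesis at `w ∤ p`

Cell `bsd-2adic` (run/shared/lean/pub/bsd-2adic/), seat `bsd-2adic-tower-1` GEN 39; `--supports stmt-BirchSwinnertonDyer-19271`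
(helper, item `OrdKatoHalfAtTwo`, TOWER road). THEOREMS ONLY (no definition, no named fact, no instance, no `sorry`); closes no item;
nothing booked; BSD is not proved by any of this.

In the levelwise Poitou–Tate call (B4, `…H46Levelwise`) the realiser class `c ∈ H¹(Γ_n, E[p^k])` is given a local condition `Lp v` at the
places `v ∈ Sp`, while the dual layer classes `b` of the orthogonality hypothesis carry the predicate `Λp v b` controlled by `Lp v` through
`hLdual`. GEN 35 used `Sp = {p}` (bad places strict for `c`, free for `b`) — adequate at the layer `n = 0` only. For the deep layer `n*`
of the B6 schedule the bad places `w ∈ S ∖ {p}` are put into `Sp` with the UNRAMIFIED condition on both sides; this file supplies the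
three plumbing facts, for an ARBITRARY finite `w ∤ p` (good or bad, `E[p^k]` ramified at `w` or not):

* §1 `resOfLe_inf_inertia_eq_zero_of_mem_unramifiedKer` — dictionary: the tree's `GreenbergVatsal2000.unramifiedKer H M w` (kernel of the
  restriction to `inertiaIn H w ≤ D_w`) gives `resOfLe M (H ⊓ I_w ≤ H) c = 0` (`I_w = GreenbergSelmer.inertia w`).
* §2 `mem_localKerOver_kerSubgroup_of_resOfLe_inertia_eq_zero_of_isCyclotomic` — **«unramified ⟹ Kummer over `K_∞`» at `w ∤ p` for
  `E[p^∞]`, cyclotomic tower, NO reduction hypothesis**: a class `T ∈ H¹(Γ_∞, E[p^∞])` vanishing on `Γ_∞ ⊓ I_w` lies in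
  `W.localKerOver p κ.kerSubgroup K_w` (Greenberg p. 70: `Gal(K_w^{nr}/K_{∞,η})` has profinite order prime to `p`, tree
  `SignedLowerOffTwo.PTDeep.resOfLe_kerSubgroup_inf_decomp_eq_zero_of_unramified`; then «locally zero ⟹ Kummer»,
  `Kobayashi2003.mem_localKerOver_of_resOfLe_inf_eq_zero`). The good-reduction hypothesis of the TP2 layer form
  (`conjH1_mem_localKerOver_layer_of_resOfLe_inertia_eq_zero_of_isCyclotomic`, Lemma 3.3 descent to `K_m`) is NOT needed over `K_∞`.
* §3 `conjH1_realiser_mem_localKerOver_of_localization_shapiroLift_mem_unramified_of_not_mem` — socket **hP at a bad place** (and the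
  Selmer reading of the ♭-classes there): if the localisation at `w ∤ p` of the Shapiro lift of `c ∈ H¹(Γ_n, E[p^k])` is unramified, then
  EVERY conjugate of the realiser `T(c) = h_n (push c)` is Kummer at `w` over `K_∞` (orbit detection on inertia for ANY `w`,
  `PrintCf2.LayerShapiro.conjH1_mem_unramifiedKer_of_localization_shapiroLift_mem`; TP2 `conjH1_push` / `resOfLe_push_eq_zero` /
  `resOfLe_kerSubgroup_inf_eq_zero_of_layer`; §2).
* §4 `localization_shapiroLift_mem_unramifiedSubgroup_of_coindTateDual_mem_dualLocalCondition` — socket **hLdual at a bad place** over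
  `ℚ` for `M = E[p^k]`, `k ≥ 1`, THE Weil pairing `weilTowerPk`: if the dual-Shapiro class `loc_w (Ψ Sh b)` lies in the dual local condition
  of `H¹_ur(ℚ_w, Maps(Γ_ℚ ⧸ Γ_n, E[p^k]))`, then `loc_w (Sh b)` is unramified — Milne I Thm. 2.6 WITHOUT the unramified hypothesis
  (`UnramifiedSelfDual.dualLocalCondition_unramifiedSubgroup_eq`, perfectness of THE canonical invariants) and the `Ψ`-transport
  `ThetaTransport.ShapiroTransport.localization_mem_unramifiedSubgroup_of_coindTateDual`.

References: [GreenbergLNM1716] §2 (p. 70), §4 Lemma 4.6 (p. 105); [MilneADT2006] I Thm. 2.6, Cor. 2.3; [NeukirchSchmidtWingberg2008]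
I §6 (1.6.4)–(1.6.5); [GreenbergVatsal2000] §2 p. 17.
-/

set_option autoImplicit false
-- the Theorems namespace of this sub repeats the summit name by design (D-0017 nested layout)
set_option linter.dupNamespace false

noncomputable section

open scoped Classical NumberField

namespace Summit.BirchSwinnertonDyer.BirchSwinnertonDyer.Theorems

namespace TorsionEulerChar.H46BadPlaces

open CategoryTheory Field NumberField IsDedekindDomain
  Literature.NumberTheory.EllipticCurves Literature.NumberTheory.EllipticCurves.CyclotomicLayer
  Literature.NumberTheory.EllipticCurves.GreenbergSelmer
  Literature.NumberTheory.GaloisRepresentations Literature.NumberTheory.GaloisRepresentations.DiscreteGaloisModule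
  Literature.NumberTheory.GaloisCohomology ZpExtension
open SignedLowerOffTwo.PTDeep

/-! ## §1 Dictionary: `unramifiedKer` ⟹ vanishing on `H ⊓ I_w` -/

section Dictionary

variable {K : Type} [Field K] [NumberField K] {M : Type} [AddCommGroup M] [DistribMulAction (absoluteGaloisGroup K) M]
  [TopologicalSpace M] [DiscreteTopology M]

/-- **`c ∈ unramifiedKer H M w ⟹ res_{H ⊓ I_w} c = 0`** (`I_w = GreenbergSelmer.inertia w`; both sides read on a representing cocycle:
«principal on `H ∩ I_w`»). [cite: GreenbergVatsal2000, §2 p. 17] [cite: SerreGaloisCohomology1997, I §5.1] -/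
theorem resOfLe_inf_inertia_eq_zero_of_mem_unramifiedKer (H : Subgroup (absoluteGaloisGroup K)) (w : HeightOneSpectrum (𝓞 K))
    {c : subgroupH1 H M} (hc : c ∈ GreenbergVatsal2000.unramifiedKer H M w) :
    resOfLe M (inf_le_left : H ⊓ GreenbergSelmer.inertia (K := K) w ≤ H) c = 0 := by
  obtain ⟨φ, rfl⟩ := oneCocycleClass_surjective _ c
  obtain ⟨m, hm⟩ := (ShaLayer.oneCocycleClass_mem_unramifiedKer_iff H w φ).1 hc
  rw [CocycleCriteria.resOfLe_oneCocycleClass_eq_zero_iff]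
  refine ⟨m, fun x ↦ ?_⟩
  obtain ⟨hxH, hxI⟩ := Subgroup.mem_inf.1 x.2
  set y : inertiaIn H w := ⟨⟨(x : absoluteGaloisGroup K), inertia_le_decomp w hxI⟩, (mem_inertiaIn_iff H w _).2 ⟨hxH, hxI⟩⟩
    with hy
  have e : Subgroup.inclusion (inf_le_left : H ⊓ GreenbergSelmer.inertia (K := K) w ≤ H) x = inertiaInToH H w y :=
    Subtype.ext rfl
  rw [e, hm y]
  rfl

end Dictionary

/-! ## §2 «Unramified ⟹ Kummer over `K_∞`» at `w ∤ p`, cyclotomic tower, no reduction hypothesis -/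

section OverKInfty

variable {K : Type} [Field K] [NumberField K] (W : WeierstrassCurve K) (p : ℕ) [Fact p.Prime] (κ : ZpExtension K p)

/-- **A class `T ∈ H¹(Γ_∞, E[p^∞])` vanishing on `Γ_∞ ⊓ I_w` is Kummer at `w` over `K_∞`**, for the CYCLOTOMIC `ℤ_p`-extension and any
finite `w ∤ p` (no reduction hypothesis on `E` at `w`): unramified ⟹ zero on `Γ_∞ ⊓ D_w` (`Gal(K_w^{nr}/K_{∞,η})` is prime-to-`p`
procyclic — no finite `w ∤ p` splits completely in `K^{cyc}_∞`) ⟹ the local condition `W.localKerOver p κ.kerSubgroup K_w`.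
[cite: GreenbergLNM1716, §2 (p. 70)] [cite: NeukirchANT1999, Ch. II §9 Prop. (9.6), (9.9)–(9.11)] -/
theorem mem_localKerOver_kerSubgroup_of_resOfLe_inertia_eq_zero_of_isCyclotomic (hκ : κ.IsCyclotomic)
    (w : HeightOneSpectrum (𝓞 K)) (hpw : (p : 𝓞 K) ∉ w.asIdeal) (T : W.subgroupH1 p κ.kerSubgroup)
    (hunr : resOfLe (W.geomPrimaryTorsion p) (inf_le_left : κ.kerSubgroup ⊓ GreenbergSelmer.inertia (K := K) w ≤ κ.kerSubgroup) T = 0) :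
    T ∈ W.localKerOver p κ.kerSubgroup (w.adicCompletion K) := by
  obtain ⟨𝔐, h𝔐⟩ := w.localPrimesAbove_nonempty
  obtain ⟨F, hF⟩ := IsDedekindDomain.HeightOneSpectrum.exists_isArithFrobAt_localAbsIntegers w h𝔐
  haveI := continuousSMul_geomPrimaryTorsion (p := p) W
  have hunr' : resOfLe (W.geomPrimaryTorsion p) (inf_le_left : κ.kerSubgroup ⊓
      (𝔐.inertia (absoluteGaloisGroup (w.adicCompletion K))).map (resGal (K := K) (w.adicCompletion K)).toMonoidHom ≤ κ.kerSubgroup)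
      T = 0 :=
    resOfLe_eq_zero_congr (W.geomPrimaryTorsion p) (by rw [map_inertia_eq_inertia w h𝔐]) _ _ hunr
  have h0 := resOfLe_kerSubgroup_inf_decomp_eq_zero_of_unramified w κ hpw h𝔐 hF
    (not_mem_localSubgroup_kerSubgroup_of_isCyclotomic w κ hκ hpw h𝔐 hF) (W.geomPrimaryTorsion p)
    (exists_pow_smul_eq_zero_geomPrimaryTorsion (p := p) W) _ hunr'
  exact Kobayashi2003.mem_localKerOver_of_resOfLe_inf_eq_zero W p (Kobayashi2003.resGalOfEmb_mem_decomp w) h0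

/-! ## §3 Socket hP at a bad place: unramified Shapiro localisation ⟹ every conjugate of the realiser is Kummer over `K_∞` -/

/-- **H46 clause (i) at ANY finite `w ∤ p` (bad places included), cyclotomic tower.** If the localisation at `w` of the Shapiro lift of
the layer class `c ∈ H¹(Γ_n, E[p^k])` is UNRAMIFIED (`∈ H¹_ur(K_w, Maps(Γ_K ⧸ Γ_n, E[p^k]))`, B4's output at `w ∈ Sp` with
`Lp w = unramifiedSubgroup`), then EVERY conjugate `conj_σ T(c)` of the realiser `T(c) = h_n (push c) ∈ H¹(Γ_∞, E[p^∞])` is Kummer at `w`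
over `K_∞`: `conj_σ T(c) ∈ W.localKerOver p κ.kerSubgroup K_w`. No hypothesis on the reduction of `E` at `w` and none on the
ramification of `E[p^k]` at `w` (orbit detection on inertia works at every `w`). The same lemma reads the unramified predicate `Λp w b` of
a ♭-class `b` as the Selmer condition of `h_n (push b)` at `w`. [cite: GreenbergLNM1716, §2 (p. 70), §4 Lemma 4.6 (p. 105)]
[cite: NeukirchSchmidtWingberg2008, I §6 Prop. (1.6.4)–(1.6.5)] -/
theorem conjH1_realiser_mem_localKerOver_of_localization_shapiroLift_mem_unramified_of_not_mem (hκ : κ.IsCyclotomic) (n k : ℕ)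
    [Fintype (absoluteGaloisGroup K ⧸ κ.layerSubgroup n)] {s : absoluteGaloisGroup K ⧸ κ.layerSubgroup n → absoluteGaloisGroup K}
    (hs : ∀ x : absoluteGaloisGroup K ⧸ κ.layerSubgroup n, (s x : absoluteGaloisGroup K ⧸ κ.layerSubgroup n) = x)
    (hs1 : s ((1 : absoluteGaloisGroup K) : absoluteGaloisGroup K ⧸ κ.layerSubgroup n) = 1)
    (w : HeightOneSpectrum (𝓞 K)) (hpw : (p : 𝓞 K) ∉ w.asIdeal)
    (c : W.torsionH1Over ((p : ℤ) ^ k) (κ.layerSubgroup n))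
    (hc : galoisCohomology.localization ((W.torsionGaloisModule ((p : ℤ) ^ k)).coind (κ.layerSubgroup n) (κ.isOpen_layerSubgroup n))
        (Sum.inr w) 1
        (shapiroLift (W.torsionGaloisModule ((p : ℤ) ^ k)).toTopRep (κ.layerSubgroup n) (κ.isOpen_layerSubgroup n) hs hs1 c) ∈
      unramifiedSubgroup (GaloisRep.toLocal w
        ((W.torsionGaloisModule ((p : ℤ) ^ k)).coind (κ.layerSubgroup n) (κ.isOpen_layerSubgroup n))) 1)
    (σ : absoluteGaloisGroup K) :
    W.conjH1 p κ.kerSubgroup σ (W.layerToInfty κ n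
        (resH1Hom (N := W.geomPrimaryTorsion p) (subgroupInclusion (le_refl (κ.layerSubgroup n)))
          (AddSubgroup.inclusion (AcSigned.geomTorsion_zpow_le_geomPrimaryTorsion W p k)) (fun _ _ ↦ rfl) c)) ∈
      W.localKerOver p κ.kerSubgroup (w.adicCompletion K) := by
  -- orbit detection on inertia (ANY `w`): `conj_σ c ∈ unramifiedKer Γ_n E[p^k] w`
  have h1 : conjH1 (κ.layerSubgroup n) (W.geomTorsion ((p : ℤ) ^ k)) σ c ∈
      GreenbergVatsal2000.unramifiedKer (κ.layerSubgroup n) (W.geomTorsion ((p : ℤ) ^ k)) w :=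
    PrintCf2.LayerShapiro.conjH1_mem_unramifiedKer_of_localization_shapiroLift_mem
      (Summit.BirchSwinnertonDyer.Rank1Residual.X11b.LocBridge.isOpen_stabilizer_geomTorsion' W ((p : ℤ) ^ k))
      (κ.layerSubgroup n) (κ.isOpen_layerSubgroup n) hs hs1 w c hc σ
  -- `conj_σ c` dies on `Γ_n ⊓ I_w`
  have h2 : resOfLe (W.geomTorsion ((p : ℤ) ^ k)) (inf_le_left : κ.layerSubgroup n ⊓ GreenbergSelmer.inertia (K := K) w ≤ κ.layerSubgroup n)
      (conjH1 (κ.layerSubgroup n) (W.geomTorsion ((p : ℤ) ^ k)) σ c) = 0 :=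
    resOfLe_inf_inertia_eq_zero_of_mem_unramifiedKer (κ.layerSubgroup n) w h1
  -- push to `E[p^∞]`, restrict to `Γ_∞`
  have h3 : resOfLe (W.geomPrimaryTorsion p) (inf_le_left : κ.kerSubgroup ⊓ GreenbergSelmer.inertia (K := K) w ≤ κ.kerSubgroup)
      (W.conjH1 p κ.kerSubgroup σ (W.layerToInfty κ n
        (resH1Hom (N := W.geomPrimaryTorsion p) (subgroupInclusion (le_refl (κ.layerSubgroup n)))
          (AddSubgroup.inclusion (AcSigned.geomTorsion_zpow_le_geomPrimaryTorsion W p k)) (fun _ _ ↦ rfl) c))) = 0 := by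
    refine resOfLe_kerSubgroup_inf_eq_zero_of_layer κ W (GreenbergSelmer.inertia (K := K) w) _ σ ?_
    rw [conjH1_push W p k σ c]
    exact resOfLe_push_eq_zero W p inf_le_left k _ h2
  exact mem_localKerOver_kerSubgroup_of_resOfLe_inertia_eq_zero_of_isCyclotomic W p κ hκ w hpw _ h3

end OverKInfty

/-! ## §4 Socket hLdual at a bad place (over `ℚ`, `M = E[p^k]`, THE Weil pairing): Milne I 2.6 without the unramified hypothesis -/

section Dual

variable (W : WeierstrassCurve ℚ) [W.IsElliptic] (p : ℕ) [hp : Fact p.Prime] (κ : ZpExtension ℚ p) (n k : ℕ)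
  [Fintype (absoluteGaloisGroup ℚ ⧸ κ.layerSubgroup n)]
  {s : absoluteGaloisGroup ℚ ⧸ κ.layerSubgroup n → absoluteGaloisGroup ℚ}
  (hs : ∀ x : absoluteGaloisGroup ℚ ⧸ κ.layerSubgroup n, (s x : absoluteGaloisGroup ℚ ⧸ κ.layerSubgroup n) = x)
  (hs1 : s ((1 : absoluteGaloisGroup ℚ) : absoluteGaloisGroup ℚ ⧸ κ.layerSubgroup n) = 1)

/-- **hLdual at a finite `w ∤ p` with `Lp w = H¹_ur`** (`k ≥ 1`). For `b ∈ H¹(Γ_n, E[p^k])`: if the localisation at `w` of the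
Weil-dual Shapiro class `H¹(Ψ)(Sh b)` lies in the dual local condition (THE canonical invariants) of the unramified subgroup
`H¹_ur(ℚ_w, Maps(Γ_ℚ ⧸ Γ_n, E[p^k]))`, then `loc_w (Sh b)` is itself unramified. Milne I Thm. 2.6 holds WITHOUT the unramified
hypothesis on the module (`UnramifiedSelfDual.dualLocalCondition_unramifiedSubgroup_eq`: counting with the perfect pairing, prime-power
level), and `Ψ` is an isomorphism commuting with the restriction to `ℚ_w^{nr}`
(`ThetaTransport.ShapiroTransport.localization_mem_unramifiedSubgroup_of_coindTateDual`). [cite: MilneADT2006, Ch. I, Thm. 2.6 and Cor. 2.3]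
[cite: SilvermanAEC2009, Prop. III.8.1] -/
theorem localization_shapiroLift_mem_unramifiedSubgroup_of_coindTateDual_mem_dualLocalCondition (hk : 0 < k)
    [Finite (W.geomTorsion ((p ^ k : ℕ) : ℤ))] [CompactSpace (absoluteGaloisGroup ℚ)]
    (w : HeightOneSpectrum (𝓞 ℚ)) (hpw : ((p : ℕ) : 𝓞 ℚ) ∉ w.asIdeal)
    (b : W.torsionH1Over ((p ^ k : ℕ) : ℤ) (κ.layerSubgroup n))
    (hdual : galoisCohomology.localization
        ((((W.torsionGaloisModule ((p ^ k : ℕ) : ℤ)).coind (κ.layerSubgroup n) (κ.isOpen_layerSubgroup n)).tateDual (p ^ k)))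
        (Sum.inr w) 1
        (cohomologyMap (coindTateDualMor (W.torsionGaloisModule ((p ^ k : ℕ) : ℤ)) (W.torsionGaloisModule ((p ^ k : ℕ) : ℤ))
            (κ.layerSubgroup n)
            (pairingHomOfFun (p ^ k) (weilTowerPk W k) (weilTowerPk_pow W k) (weilTowerPk_add_left W k) (weilTowerPk_add_right W k))
            (κ.isOpen_layerSubgroup n)
            (fun σ a b => (contPairingOfFun (W.torsionGaloisModule ((p ^ k : ℕ) : ℤ)) (p ^ k) (weilTowerPk W k) (weilTowerPk_pow W k)
              (weilTowerPk_add_left W k) (weilTowerPk_add_right W k) (weilTowerPk_smul W k)).toLin_smul σ a b)) 1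
          (shapiroLift (W.torsionGaloisModule ((p ^ k : ℕ) : ℤ)).toTopRep (κ.layerSubgroup n) (κ.isOpen_layerSubgroup n) hs hs1 b)) ∈
      (LocalInvariants.canonical ℚ (p ^ k)).dualLocalCondition
        ((W.torsionGaloisModule ((p ^ k : ℕ) : ℤ)).coind (κ.layerSubgroup n) (κ.isOpen_layerSubgroup n)) (Sum.inr w)
        (unramifiedSubgroup (GaloisRep.toLocal w
          ((W.torsionGaloisModule ((p ^ k : ℕ) : ℤ)).coind (κ.layerSubgroup n) (κ.isOpen_layerSubgroup n))) 1)) :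
    galoisCohomology.localization ((W.torsionGaloisModule ((p ^ k : ℕ) : ℤ)).coind (κ.layerSubgroup n) (κ.isOpen_layerSubgroup n))
        (Sum.inr w) 1
        (shapiroLift (W.torsionGaloisModule ((p ^ k : ℕ) : ℤ)).toTopRep (κ.layerSubgroup n) (κ.isOpen_layerSubgroup n) hs hs1 b) ∈
      unramifiedSubgroup (GaloisRep.toLocal w
        ((W.torsionGaloisModule ((p ^ k : ℕ) : ℤ)).coind (κ.layerSubgroup n) (κ.isOpen_layerSubgroup n))) 1 := by
  haveI : NeZero (p ^ k) := ⟨pow_ne_zero k hp.out.ne_zero⟩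
  have hNM : ∀ m : W.geomTorsion ((p ^ k : ℕ) : ℤ), (p ^ k) • m = 0 := fun m =>
    AddSubgroup.torsionBy.nsmul (A := W.geomPoints) (n := p ^ k) m
  have hM : ∀ m : absoluteGaloisGroup ℚ ⧸ κ.layerSubgroup n → W.geomTorsion ((p ^ k : ℕ) : ℤ), (p ^ k) • m = 0 :=
    fun φ => funext fun y => hNM (φ y)
  have hw' : ((p ^ k : ℕ) : 𝓞 ℚ) ∉ w.asIdeal := by
    rw [Nat.cast_pow]
    exact fun h ↦ hpw (w.isPrime.mem_of_pow_mem k h)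
  have hpp : IsPrimePow (p ^ k) := ⟨p, k, hp.out.prime, hk, rfl⟩
  rw [(UnramifiedSelfDual.dualLocalCondition_unramifiedSubgroup_eq (LocalInvariants.canonical ℚ (p ^ k)) hpp
    LocalInvariants.canonical_isPerfect _ hM w hw').1] at hdual
  exact ThetaTransport.ShapiroTransport.localization_mem_unramifiedSubgroup_of_coindTateDual (W.torsionGaloisModule ((p ^ k : ℕ) : ℤ))
    (p ^ k) (weilTowerPk W k) (weilTowerPk_pow W k) (weilTowerPk_add_left W k) (weilTowerPk_add_right W k) (weilTowerPk_smul W k)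
    (κ.layerSubgroup n) (κ.isOpen_layerSubgroup n) (SignedLowerOffTwo.PTDeep.weilTowerPk_nondegenerate W k) hNM w _ hdual

end Dual

end TorsionEulerChar.H46BadPlaces

end Summit.BirchSwinnertonDyer.BirchSwinnertonDyer.Theorems

end
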